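import Mathlib
import Literature.Analysis.FluidPDE.Tao2016AveragedNS.RestartedCascadeFlows
import Summits.NavierStokesRegularity.NavierStokesRegularity.Theses.TaoLadderRungThree
import Summits.NavierStokesRegularity.NavierStokesRegularity.Theses.TaoLadderRungTwo
import HarnessLib

/-!
# `LocalDynamicsSufficesAt` — the local robust checkpoint induction implies Theorem 4.2-level
  blow-up at one scale ratio (item stmt-NavierStokesRegularity-20426, shared support of routes
  TaoLadderRungThree / TaoLadderRungTwo)

HONEST FRAMING: bookkeeping about Tao-type MODEL lattice pseudo-flows (Tao 2016, §6.2: "Theorem 6.2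
⇐ Proposition 6.3", with the inductive step "Proposition 6.4" abstracted as the cell predicate
`TaoCascade.DynamicsLocalAt`). Nothing here is a statement about the Navier–Stokes equations, and
nothing is asserted about any particular coefficient table: the theorem is an implication whose
hypothesis `DynamicsLocalAt ε₀ R` is an open existence question.

**Statement (`LocalDynamicsSufficesAt`).** For `ε₀ > 0` and `R ≥ 1`, `DynamicsLocalAt ε₀ R` implies
that some table `α ∈ InTableClass R` and datum `X₀` have `NoGlobalCascade ε₀ α X₀`.

PROOF. Take the table, datum, descriptions `P, Q`, exponent `0 ≤ θ < 5/2` and clock `c > 0` of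
`DynamicsLocalAt`. By the tree theorem `TaoCascade.noGlobalCascade_of_forall_shellCheckpoints`
("checkpoints at every level contradict (4.5)", Tao §6.2 p. 32) it suffices, for all `K₁, K₂ ≥ 0` and
`n₀ ≥ N₀` (the threshold of the (step) clause), to produce along every GLOBAL pseudo-solution shell
checkpoints at every level `N ≥ n₀`. Induct on `N`: at `N = n₀` take `t ≡ 0`, `e ≡ |X₀ i₀|` (anchor
(6.9)–(6.10); the state clause is the base clause of `DynamicsLocalAt` by
`CascadeODESolutionOn.window_zero`; the epoch clauses are vacuous); at `N → N+1` restrict the global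
solution to `[0, T]` with `T := t_N + c(1+ε₀)^{-5N/2}/e_N` (`CascadeODESolutionFrom.restrict`) and
apply the (step) clause. Forget the epoch description at the end (`EpochCheckpoints.forget`).
-/

noncomputable section

-- the sub-problem namespace `Summit.NavierStokesRegularity.NavierStokesRegularity` repeats the summit name by design (D-0017)
set_option linter.dupNamespace false

namespace Summit.NavierStokesRegularity.NavierStokesRegularity.Theorems

open Set Literature.Analysis.FluidPDE Literature.Analysis.FluidPDE.TaoCascade

namespace LocalDynamicsSufficesAt

variable {ε₀ θ c : ℝ} {m : ℕ} {i₀ : Fin m} {α : Fin m → Fin m → Fin m → ℤ × ℤ × ℤ → ℝ}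
  {K₁ K₂ : ℝ} {n₀ : ℤ} {X₀ : Fin m → ℝ} {P Q : (Fin m → ℤ → ℝ) → (Fin m → ℤ → ℝ) → Prop}
  {X E : Fin m → ℤ → ℝ → ℝ}

/-- **Base of the induction**: along a local pseudo-solution whose rescaled datum satisfies the
transition-state description `P`, the constant sequences `t ≡ 0`, `e ≡ |X₀ i₀|` are epoch
checkpoints up to the datum level `n₀` (anchor (6.9)–(6.10); no epochs yet).
[cite: Tao2016AveragedNS, §6.2 (6.9)–(6.10) ("we initialise t_{n₀} := 0 and e_{n₀} := 1")] -/
theorem epochCheckpoints_init {T : ℝ} (hsol : CascadeODESolutionOn T ε₀ α K₁ K₂ n₀ X₀ X E)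
    (hX₀ : X₀ i₀ ≠ 0) (hP : P (datumState i₀ X₀) (datumEnergy i₀ X₀)) :
    EpochCheckpoints ε₀ θ c i₀ n₀ X₀ P Q n₀ X E (fun _ => 0) (fun _ => |X₀ i₀|) where
  t_init := rfl
  e_init := rfl
  e_pos n _ _ := abs_pos.mpr hX₀
  amp n hn hnN := by
    obtain rfl : n = n₀ := le_antisymm hnN hn
    rw [hsol.X_zero_self]
  state n hn hnN := by
    obtain rfl : n = n₀ := le_antisymm hnN hn
    obtain ⟨h1, h2⟩ := hsol.window_zero i₀
    rw [h1, h2]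
    exact hP
  mono n hn hnN := absurd hnN (not_le.mpr hn)
  life n hn hnN := absurd hnN (not_le.mpr hn)
  ratio n hn hnN := absurd hnN (not_le.mpr hn)
  epoch n hn hnN := absurd hnN (not_le.mpr hn)

/-- **The induction**: if along a GLOBAL pseudo-solution every run of epoch checkpoints up to a level
`N ≥ n₀` extends to level `N+1` as soon as the next lifespan fits inside a horizon on which the
solution is a local pseudo-solution (it always does: restrict the global solution to
`[0, t_N + c(1+ε₀)^{-5N/2}/e_N]`), then epoch checkpoints exist at every level.
[cite: Tao2016AveragedNS, §6.2 p. 32 (Prop. 6.3 by induction on N from Prop. 6.4)] -/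
theorem forall_exists_epochCheckpoints (hε₀ : 0 < ε₀) (hc : 0 < c)
    (hsol : CascadeODESolutionFrom ε₀ α K₁ K₂ n₀ X₀ X E) (hX₀ : X₀ i₀ ≠ 0)
    (hP : P (datumState i₀ X₀) (datumEnergy i₀ X₀))
    (hstep : ∀ T : ℝ, 0 < T → CascadeODESolutionOn T ε₀ α K₁ K₂ n₀ X₀ X E →
      ∀ N : ℤ, n₀ ≤ N → ∀ t e : ℤ → ℝ, EpochCheckpoints ε₀ θ c i₀ n₀ X₀ P Q N X E t e →
        t N + c * (1 + ε₀) ^ (-(5 : ℝ) * N / 2) * (e N)⁻¹ ≤ T →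
          ∃ s a : ℝ, EpochCheckpoints ε₀ θ c i₀ n₀ X₀ P Q (N + 1) X E
            (Function.update t (N + 1) s) (Function.update e (N + 1) a)) :
    ∀ N : ℤ, n₀ ≤ N → ∃ t e : ℤ → ℝ, EpochCheckpoints ε₀ θ c i₀ n₀ X₀ P Q N X E t e := by
  intro N hN
  obtain ⟨k, rfl⟩ : ∃ k : ℕ, N = n₀ + k := ⟨(N - n₀).toNat, by omega⟩
  induction k with
  | zero =>
      refine ⟨fun _ => 0, fun _ => |X₀ i₀|, ?_⟩
      simpa using epochCheckpoints_init (θ := θ) (c := c) (Q := Q) (hsol.restrict one_pos) hX₀ hP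
  | succ k ih =>
      obtain ⟨t, e, h⟩ := ih (by omega)
      have hq : (0 : ℝ) < 1 + ε₀ := by linarith
      have heN : 0 < e (n₀ + k) := h.e_pos (n₀ + k) (by omega) le_rfl
      have htN : 0 ≤ t (n₀ + k) := h.t_nonneg (n₀ + k) (by omega) le_rfl
      set T : ℝ := t (n₀ + k) + c * (1 + ε₀) ^ (-(5 : ℝ) * ((n₀ + k : ℤ) : ℝ) / 2) * (e (n₀ + k))⁻¹
        with hT
      have hTpos : 0 < T := by
        have : 0 < c * (1 + ε₀) ^ (-(5 : ℝ) * ((n₀ + k : ℤ) : ℝ) / 2) * (e (n₀ + k))⁻¹ :=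
          mul_pos (mul_pos hc (Real.rpow_pos_of_pos hq _)) (inv_pos.mpr heN)
        linarith
      obtain ⟨s, a, h'⟩ := hstep T hTpos (hsol.restrict hTpos) (n₀ + k) (by omega) t e h le_rfl
      have hidx : n₀ + ((k + 1 : ℕ) : ℤ) = n₀ + (k : ℤ) + 1 := by push_cast; ring
      rw [hidx]
      exact ⟨_, _, h'⟩

/-- **`LocalDynamicsSufficesAt`, main lemma** (general number of modes): `DynamicsLocalAt`-shaped
data — base clause at the rescaled datum and the local (step) clause with threshold `N₀(K₁, K₂)` —
give `NoGlobalCascade ε₀ α X₀`. [cite: Tao2016AveragedNS, §6.2 p. 32 (Thm. 6.2 from Props. 6.3–6.4) with §6.1 p. 31] -/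
theorem noGlobalCascade_of_local (hε₀ : 0 < ε₀) (hθ : θ < 5 / 2) (hc : 0 < c) (hX₀ : X₀ i₀ ≠ 0)
    (hP : P (datumState i₀ X₀) (datumEnergy i₀ X₀))
    (hstep : ∀ K₁ K₂ : ℝ, 0 ≤ K₁ → 0 ≤ K₂ → ∃ N₀ : ℤ, ∀ n₀ : ℤ, N₀ ≤ n₀ →
      ∀ T : ℝ, 0 < T → ∀ X E : Fin m → ℤ → ℝ → ℝ,
        CascadeODESolutionOn T ε₀ α K₁ K₂ n₀ X₀ X E →
          ∀ N : ℤ, n₀ ≤ N → ∀ t e : ℤ → ℝ, EpochCheckpoints ε₀ θ c i₀ n₀ X₀ P Q N X E t e →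
            t N + c * (1 + ε₀) ^ (-(5 : ℝ) * N / 2) * (e N)⁻¹ ≤ T →
              ∃ s a : ℝ, EpochCheckpoints ε₀ θ c i₀ n₀ X₀ P Q (N + 1) X E
                (Function.update t (N + 1) s) (Function.update e (N + 1) a)) :
    NoGlobalCascade ε₀ α X₀ := by
  refine noGlobalCascade_of_forall_shellCheckpoints (θ := θ) (c := c) (i₀ := i₀) (P := P) hε₀ hθ
    hc.le fun K₁ K₂ hK₁ hK₂ => ?_
  obtain ⟨N₀, hN₀⟩ := hstep K₁ K₂ hK₁ hK₂
  refine ⟨N₀, fun n₀ hn₀ X E hsol N hN => ?_⟩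
  obtain ⟨t, e, h⟩ := forall_exists_epochCheckpoints (Q := Q) hε₀ hc hsol hX₀ hP
    (fun T hT hloc N hN t e h hfit => hN₀ n₀ hn₀ T hT X E hloc N hN t e h hfit) N hN
  exact ⟨t, e, h.forget⟩

end LocalDynamicsSufficesAt

open LocalDynamicsSufficesAt in
/-- **Item stmt-NavierStokesRegularity-20426** (`TaoLadderRungThree.LocalDynamicsSufficesAt`): for
`ε₀ > 0` and `R ≥ 1`, `DynamicsLocalAt ε₀ R` gives a table `α ∈ InTableClass R` and a datum `X₀`
with `NoGlobalCascade ε₀ α X₀` (the table and datum of `DynamicsLocalAt` itself).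
[cite: Tao2016AveragedNS, §6.2 p. 32 with §6.1 p. 31] -/
theorem taoLadderRungThree_localDynamicsSufficesAt_proof :
    Summit.NavierStokesRegularity.NavierStokesRegularity.Theses.TaoLadderRungThree.LocalDynamicsSufficesAt := by
  unfold Summit.NavierStokesRegularity.NavierStokesRegularity.Theses.TaoLadderRungThree.LocalDynamicsSufficesAt
  intro ε₀ R hε₀ _hR hdyn
  obtain ⟨θ, c, i₀, α, X₀, P, Q, _hθ0, hθ, hc, hα, hX₀, hP, hstep⟩ := hdyn
  exact ⟨α, X₀, hα, noGlobalCascade_of_local (Q := Q) hε₀ hθ hc hX₀ hP hstep⟩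

open LocalDynamicsSufficesAt in
/-- **The same item read in route TaoLadderRungTwo** (`TaoLadderRungTwo.LocalDynamicsSufficesAt`, the
shared support stmt-NavierStokesRegularity-20426; identical statement).
[cite: Tao2016AveragedNS, §6.2 p. 32 with §6.1 p. 31] -/
theorem taoLadderRungTwo_localDynamicsSufficesAt_proof :
    Summit.NavierStokesRegularity.NavierStokesRegularity.Theses.TaoLadderRungTwo.LocalDynamicsSufficesAt := by
  unfold Summit.NavierStokesRegularity.NavierStokesRegularity.Theses.TaoLadderRungTwo.LocalDynamicsSufficesAt
  intro ε₀ R hε₀ _hR hdyn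
  obtain ⟨θ, c, i₀, α, X₀, P, Q, _hθ0, hθ, hc, hα, hX₀, hP, hstep⟩ := hdyn
  exact ⟨α, X₀, hα, noGlobalCascade_of_local (Q := Q) hε₀ hθ hc hX₀ hP hstep⟩

end Summit.NavierStokesRegularity.NavierStokesRegularity.Theorems

end
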